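import Literature.Analysis.FluidPDE.OnsagerBDSVTransportHigher
import Literature.Analysis.FunctionSpaces.HolderLogConvexity
import HarnessLib

/-!
# BDSV App. D, Prop. D.1: the commutator estimate at all orders from its order-zero case

Buckmaster–De Lellis–Székelyhidi–Vicol (BDSV), *Onsager's conjecture for admissible weak
solutions*, CPAM 72 (2019) 229–274 = arXiv:1701.08678, App. D, Prop. D.1 (a variant of
Constantin 2015, Lemma 1): for `α ∈ (0,1)`, `N ≥ 0`, a Calderón–Zygmund operator `T_K` and a
vector field `b ∈ C^{N+1,α}(T³)`,
`‖[T_K, b·∇] f‖_{N+α} ≲ ‖b‖_{1+α}‖f‖_{N+α} + ‖b‖_{N+1+α}‖f‖_α`. The tree transcribes it for the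
second Riesz transforms `T = ∂ᵢ∂ⱼΔ⁻¹` as the named fact `BDSV.commutatorCZBound`
(`OnsagerBDSVPotentialTheory.lean`), the last analytic input of the gluing stages of BDSV
(`BDSV.gluedTripleEstimates_of_commutatorCZBound`) and of De Rosa 2019
(`DeRosa.gluingStage_of_localExistence_of_commutatorCZBound`).

The printed proof has two halves: the case `N = 0` "is precisely Lemma 1 in [Co2015]"
(a singular-integral estimate), and the case `N ≥ 1` follows from it: "by the Leibniz rule
`∂^θ[T_K, b·∇]f = ∑_{θ'} (θ choose θ') [T_K, ∂^{θ'}b·∇] ∂^{θ-θ'}f` … Therefore we obtain from the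
case `N = 0`: `‖∂^θ[T_K, b·∇]f‖_α ≲ ∑_{j=0}^N ‖b‖_{j+1+α}‖f‖_{N-j+α}`. Furthermore, by interpolation
`‖b‖_{j+1+α} ≲ ‖b‖_{1+α}^{1-j/N}‖b‖_{N+1+α}^{j/N}` and `‖f‖_{N-j+α} ≲ ‖f‖_{N+α}^{1-j/N}‖f‖_α^{j/N}`,
so that `‖b‖_{j+1+α}‖f‖_{N-j+α} ≲ ‖b‖_{1+α}‖f‖_{N+α} + ‖b‖_{N+1+α}‖f‖_α`. This concludes the
proof." This file PROVES the second half, for the operators of the named fact and in the tree's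
norms `Torus.eContDiffHolderNorm N α` (everything proved; no definitions, no named facts):

* `Torus.exists_eContDiffHolderNorm_mul_le_ends` — the **two-function interpolation
  inequality** `‖b‖_{p+j,r}‖f‖_{q+n-j,r} ≤ K(p,q,n) (‖b‖_{p,r}‖f‖_{q+n,r} + ‖b‖_{p+n,r}‖f‖_{q,r})`
  for smooth `b`, `f` on `T^d`, `r ≤ 1`, `j ≤ n` (the printed interpolation step, derived from the
  tree's three-orders inequality `Torus.sq_eContDiffHolderNorm_succ_le` (BDSV (A.4)) through the
  almost-convexity of `j ↦ log ‖b‖_{p+j,r} + log ‖f‖_{q+n-j,r}` and `discreteConvex_le`);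
* `BDSV.partialDeriv_czCommutator` — the printed Leibniz rule for the commutator, one
  derivative at a time (from the tree's `BDSV.partialDeriv_convect`,
  `∂ₖ((u·∇)v) = (∂ₖu·∇)v + (u·∇)∂ₖv`):
  `∂ₖ[∂ᵢ∂ⱼΔ⁻¹, b·∇]f = [∂ᵢ∂ⱼΔ⁻¹, ∂ₖb·∇]f + [∂ᵢ∂ⱼΔ⁻¹, b·∇]∂ₖf` (`∂ₖ` commutes with `∂ᵢ∂ⱼΔ⁻¹`,
  `BDSV.partialDeriv_rieszHessian`);
* `BDSV.czCommutator_bound_succ`, `BDSV.czCommutator_bound_of_order_zero` — the induction on the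
  order (`‖g‖_{N+1,α} ≤ ‖g‖_∞ + ∑ₖ ‖∂ₖg‖_{N,α}`, `BDSV.eContDiffHolderNorm_succ_le_sum`), with
  explicit constants `C_{N+1} = C_N (6K + 9)`;
* `BDSV.commutatorCZBound_of_order_zero` — **`BDSV.commutatorCZBound` from its case `N = 0`**
  (`‖[∂ᵢ∂ⱼΔ⁻¹, b·∇]f‖_{0,α} ≤ C₀(α) ‖b‖_{1,α}‖f‖_{0,α}` for smooth `b`, `f`, `0 < α < 1`).

The order-zero case itself (Constantin's Lemma 1 for `∂ᵢ∂ⱼΔ⁻¹` on `T³`) is not proved here; the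
tree approaches it through the heat semigroup (`UnboundedOperators/HeatKernelCommutator.lean`).

## References

* T. Buckmaster, C. De Lellis, L. Székelyhidi Jr., V. Vicol, *Onsager's conjecture for admissible
  weak solutions*, Comm. Pure Appl. Math. 72 (2019) 229–274 = arXiv:1701.08678, App. D,
  Prop. D.1 and its proof (arXiv p. 24), App. A (A.4). [`BuckmasterEtAl2018`]
* P. Constantin, *Lagrangian–Eulerian methods for uniqueness in hydrodynamic systems*, Adv. Math.
  278 (2015) 67–102, Lemma 1 (the case `N = 0`).
-/

noncomputable section

open Set Function
open scoped NNReal ENNReal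

namespace Literature.Analysis.FunctionSpaces

/-- An elementary exponentiation step: from `n c ≤ (n - j) c₀ + j c₁ + E` for the logarithms
`c = log P`, `c₀ = log P₀`, `c₁ = log P₁` of positive reals and `E = n log G` (`G ≥ 1`, `n ≥ 1`,
`j ≤ n`), `P ≤ G max P₀ P₁`. [folklore] -/
theorem le_mul_max_of_log_combination {P P₀ P₁ G : ℝ} (hP : 0 < P) (hP₀ : 0 < P₀) (hP₁ : 0 < P₁)
    (hG : 1 ≤ G) {n j : ℕ} (hn : 1 ≤ n) (hj : j ≤ n)
    (h : (n : ℝ) * Real.log P ≤ ((n - j : ℕ) : ℝ) * Real.log P₀ + (j : ℝ) * Real.log P₁ +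
      (n : ℝ) * Real.log G) :
    P ≤ G * max P₀ P₁ := by
  set M : ℝ := max P₀ P₁ with hM
  have hM0 : 0 < M := lt_max_of_lt_left hP₀
  have hlog₀ : Real.log P₀ ≤ Real.log M := Real.log_le_log hP₀ (le_max_left _ _)
  have hlog₁ : Real.log P₁ ≤ Real.log M := Real.log_le_log hP₁ (le_max_right _ _)
  have hnj : ((n - j : ℕ) : ℝ) = (n : ℝ) - (j : ℝ) := by
    rw [Nat.cast_sub hj]
  have hj0 : (0 : ℝ) ≤ j := Nat.cast_nonneg j
  have hnj0 : (0 : ℝ) ≤ (n : ℝ) - (j : ℝ) := by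
    rw [← hnj]; exact Nat.cast_nonneg _
  have h1 : (n : ℝ) * Real.log P ≤ (n : ℝ) * (Real.log M + Real.log G) := by
    rw [hnj] at h
    have := mul_le_mul_of_nonneg_left hlog₀ hnj0
    have := mul_le_mul_of_nonneg_left hlog₁ hj0
    nlinarith
  have hn0 : (0 : ℝ) < n := by exact_mod_cast hn
  have h2 : Real.log P ≤ Real.log (G * M) := by
    rw [Real.log_mul (by linarith) hM0.ne', add_comm]
    exact le_of_mul_le_mul_left h1 hn0
  exact (Real.log_le_log_iff hP (mul_pos (by linarith) hM0)).1 h2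

namespace Torus

universe u

variable {d : Type u} [Fintype d] {Y Y' : Type u} [NormedAddCommGroup Y] [NormedSpace ℝ Y]
  [NormedAddCommGroup Y'] [NormedSpace ℝ Y']

/-- **Interpolation between two functions** (the form in which BDSV use App. A (A.4) in the proof
of App. D, Prop. D.1: "`‖b‖_{j+1+α} ≲ ‖b‖_{1+α}^{1-j/N}‖b‖_{N+1+α}^{j/N}` and
`‖f‖_{N-j+α} ≲ ‖f‖_{N+α}^{1-j/N}‖f‖_α^{j/N}`, so that
`‖b‖_{j+1+α}‖f‖_{N-j+α} ≲ ‖b‖_{1+α}‖f‖_{N+α} + ‖b‖_{N+1+α}‖f‖_α`"). For smooth `b`, `f` on `T^d`,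
`r ≤ 1`, base orders `p`, `q` and a span `n`: there is `K = K(p, q, n)` with
`‖b‖_{p+j,r} ‖f‖_{q+(n-j),r} ≤ K (‖b‖_{p,r} ‖f‖_{q+n,r} + ‖b‖_{p+n,r} ‖f‖_{q,r})` for all `j ≤ n`
(the sequence `j ↦ log ‖b‖_{p+j,r} + log ‖f‖_{q+n-j,r}` is convex up to the error
`log(64 (p+n+3)² (q+n+3)²)` by the three-orders inequality
`Torus.sq_eContDiffHolderNorm_succ_le`, and `discreteConvex_le` bounds it by its end values).
[cite: BuckmasterEtAl2018, App. A (A.4) and App. D (proof of Prop. D.1)] -/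
theorem exists_eContDiffHolderNorm_mul_le_ends (p q n : ℕ) {r : ℝ≥0} (hr : r ≤ 1) :
    ∃ K : ℝ≥0, ∀ (b : UnitAddTorus d → Y) (f : UnitAddTorus d → Y'), IsSmooth b → IsSmooth f →
      ∀ j, j ≤ n →
        Torus.eContDiffHolderNorm (p + j) r b * Torus.eContDiffHolderNorm (q + (n - j)) r f ≤
          (K : ℝ≥0∞) * (Torus.eContDiffHolderNorm p r b * Torus.eContDiffHolderNorm (q + n) r f +
            Torus.eContDiffHolderNorm (p + n) r b * Torus.eContDiffHolderNorm q r f) := by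
  -- the constants
  set ΛA : ℝ := 8 * ((p + n : ℕ) + 3 : ℝ) ^ 2 with hΛA
  set ΛB : ℝ := 8 * ((q + n : ℕ) + 3 : ℝ) ^ 2 with hΛB
  have hΛA1 : 1 ≤ ΛA := by
    have : (3 : ℝ) ≤ ((p + n : ℕ) : ℝ) + 3 := by linarith [Nat.cast_nonneg (α := ℝ) (p + n)]
    rw [hΛA]; nlinarith
  have hΛB1 : 1 ≤ ΛB := by
    have : (3 : ℝ) ≤ ((q + n : ℕ) : ℝ) + 3 := by linarith [Nat.cast_nonneg (α := ℝ) (q + n)]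
    rw [hΛB]; nlinarith
  set G : ℝ := (ΛA * ΛB) ^ (2 * n ^ 2) with hG
  have hG1 : 1 ≤ G := one_le_pow₀ (one_le_mul_of_one_le_of_one_le hΛA1 hΛB1)
  have hG0 : 0 ≤ G := zero_le_one.trans hG1
  refine ⟨G.toNNReal, fun b f hb hf j hj => ?_⟩
  have hKG : ((G.toNNReal : ℝ≥0) : ℝ≥0∞) = ENNReal.ofReal G := rfl
  rw [hKG]
  -- trivial cases: one of the functions has all norms zero
  rcases eContDiffHolderNorm_toReal_pos_or_eq_zero hb hr with hApos | hAzero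
  swap
  · rw [hAzero (p + j), zero_mul]; exact bot_le
  rcases eContDiffHolderNorm_toReal_pos_or_eq_zero hf hr with hBpos | hBzero
  swap
  · rw [hBzero (q + (n - j)), mul_zero]; exact bot_le
  -- real sequences
  have hfinA : ∀ i, Torus.eContDiffHolderNorm i r b ≠ ⊤ := fun i =>
    (hb.eContDiffHolderNorm_lt_top i hr).ne
  have hfinB : ∀ i, Torus.eContDiffHolderNorm i r f ≠ ⊤ := fun i =>
    (hf.eContDiffHolderNorm_lt_top i hr).ne
  set A : ℕ → ℝ := fun i => (Torus.eContDiffHolderNorm i r b).toReal with hA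
  set B : ℕ → ℝ := fun i => (Torus.eContDiffHolderNorm i r f).toReal with hB
  have hA_eq : ∀ i, Torus.eContDiffHolderNorm i r b = ENNReal.ofReal (A i) := fun i =>
    (ENNReal.ofReal_toReal (hfinA i)).symm
  have hB_eq : ∀ i, Torus.eContDiffHolderNorm i r f = ENNReal.ofReal (B i) := fun i =>
    (ENNReal.ofReal_toReal (hfinB i)).symm
  -- the goal in real form
  rw [hA_eq, hB_eq, hA_eq p, hB_eq (q + n), hA_eq (p + n), hB_eq q,
    ← ENNReal.ofReal_mul (hApos _).le, ← ENNReal.ofReal_mul (hApos _).le,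
    ← ENNReal.ofReal_mul (hApos _).le, ← ENNReal.ofReal_add (mul_pos (hApos _) (hBpos _)).le
      (mul_pos (hApos _) (hBpos _)).le, ← ENNReal.ofReal_mul hG0]
  refine ENNReal.ofReal_le_ofReal ?_
  -- the case `n = 0`
  rcases Nat.eq_zero_or_pos n with hn0 | hnpos
  · subst hn0
    have hj0 : j = 0 := by omega
    subst hj0
    simp only [add_zero, Nat.sub_zero]
    have hP : 0 ≤ A p * B q := (mul_pos (hApos _) (hBpos _)).le
    nlinarith
  -- the almost-convex sequence of logarithms
  set c : ℕ → ℝ := fun i => Real.log (A (p + i)) + Real.log (B (q + (n - i))) with hc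
  set γ : ℝ := Real.log ΛA + Real.log ΛB with hγ
  have hγ0 : 0 ≤ γ := add_nonneg (Real.log_nonneg hΛA1) (Real.log_nonneg hΛB1)
  have hconvA : ∀ i, i + 2 ≤ n →
      2 * Real.log (A (p + i + 1)) ≤ Real.log (A (p + i)) + Real.log (A (p + i + 2)) + Real.log ΛA := by
    intro i hi
    have h3 := sq_toReal_eContDiffHolderNorm_succ_le hb hr (p + i)
    have hi3 : 8 * (((p + i : ℕ) : ℝ) + 3) ^ 2 ≤ ΛA := by
      rw [hΛA]
      have h0 : (0 : ℝ) ≤ ((p + i : ℕ) : ℝ) + 3 := by positivity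
      have : (((p + i : ℕ) : ℝ) + 3) ≤ ((p + n : ℕ) : ℝ) + 3 := by
        have : ((p + i : ℕ) : ℝ) ≤ ((p + n : ℕ) : ℝ) := by exact_mod_cast (by omega : p + i ≤ p + n)
        linarith
      nlinarith
    have h4 : A (p + i + 1) ^ 2 ≤ ΛA * A (p + i) * A (p + i + 2) := by
      refine h3.trans ?_
      have := mul_le_mul_of_nonneg_right hi3
        (mul_nonneg (hApos (p + i)).le (hApos (p + i + 2)).le)
      nlinarith [this]
    have hlog := Real.log_le_log (pow_pos (hApos _) 2) h4
    rw [Real.log_pow, Real.log_mul (mul_pos (by linarith) (hApos _)).ne' (hApos _).ne',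
      Real.log_mul (by linarith) (hApos _).ne'] at hlog
    push_cast at hlog
    linarith
  have hconvB : ∀ k, 2 * Real.log (B (k + 1)) ≤ Real.log (B k) + Real.log (B (k + 2)) +
      Real.log (8 * ((k : ℝ) + 3) ^ 2) := by
    intro k
    have h3 := sq_toReal_eContDiffHolderNorm_succ_le hf hr k
    have h8 : (0 : ℝ) < 8 * ((k : ℝ) + 3) ^ 2 := by positivity
    have h4 : B (k + 1) ^ 2 ≤ (8 * ((k : ℝ) + 3) ^ 2) * B k * B (k + 2) := h3
    have hlog := Real.log_le_log (pow_pos (hBpos _) 2) h4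
    rw [Real.log_pow, Real.log_mul (mul_pos h8 (hBpos _)).ne' (hBpos _).ne',
      Real.log_mul h8.ne' (hBpos _).ne'] at hlog
    push_cast at hlog
    linarith
  have hconv : ∀ i, i + 2 ≤ n → 2 * c (0 + i + 1) ≤ c (0 + i) + c (0 + i + 2) + γ := by
    intro i hi
    simp only [hc, zero_add]
    have hAi := hconvA i hi
    -- the `f`-part at `k = q + (n - (i + 2))`
    have hBi := hconvB (q + (n - (i + 2)))
    have e1 : q + (n - (i + 2)) + 1 = q + (n - (i + 1)) := by omega
    have e2 : q + (n - (i + 2)) + 2 = q + (n - i) := by omega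
    rw [e1, e2] at hBi
    have hk3 : Real.log (8 * (((q + (n - (i + 2)) : ℕ) : ℝ) + 3) ^ 2) ≤ Real.log ΛB := by
      refine Real.log_le_log (by positivity) ?_
      rw [hΛB]
      have h0 : (0 : ℝ) ≤ ((q + (n - (i + 2)) : ℕ) : ℝ) + 3 := by positivity
      have : (((q + (n - (i + 2)) : ℕ) : ℝ) + 3) ≤ ((q + n : ℕ) : ℝ) + 3 := by
        have : ((q + (n - (i + 2)) : ℕ) : ℝ) ≤ ((q + n : ℕ) : ℝ) := by
          exact_mod_cast (by omega : q + (n - (i + 2)) ≤ q + n)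
        linarith
      nlinarith
    have e3 : p + (i + 1) = p + i + 1 := by ring
    have e4 : p + (i + 2) = p + i + 2 := by ring
    rw [e3, e4, hγ]
    linarith
  -- discrete convexity between `0` and `n`
  have hdc := discreteConvex_le (k := 0) (n := n) hγ0 hconv (n₁ := j) (n₂ := n - j) (by omega)
  simp only [hc, zero_add, Nat.sub_self, add_zero] at hdc
  -- `c j = log P_j` etc.
  have hPj : 0 < A (p + j) * B (q + (n - j)) := mul_pos (hApos _) (hBpos _)
  have hP0 : 0 < A p * B (q + n) := mul_pos (hApos _) (hBpos _)
  have hPn : 0 < A (p + n) * B q := mul_pos (hApos _) (hBpos _)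
  have key : (n : ℝ) * Real.log (A (p + j) * B (q + (n - j))) ≤
      ((n - j : ℕ) : ℝ) * Real.log (A p * B (q + n)) + (j : ℝ) * Real.log (A (p + n) * B q) +
        (n : ℝ) * Real.log G := by
    rw [Real.log_mul (hApos _).ne' (hBpos _).ne', Real.log_mul (hApos _).ne' (hBpos _).ne',
      Real.log_mul (hApos _).ne' (hBpos _).ne', hG, Real.log_pow,
      Real.log_mul (by linarith) (by linarith), ← hγ]
    have hn3 : 2 * γ * (n : ℝ) ^ 3 = (n : ℝ) * (((2 * n ^ 2 : ℕ) : ℝ) * γ) := by push_cast; ring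
    simp only [Nat.sub_zero] at hdc
    linarith [hdc, hn3]
  have hmain := le_mul_max_of_log_combination hPj hP0 hPn hG1 hnpos hj key
  refine hmain.trans ?_
  exact mul_le_mul_of_nonneg_left (max_le_add_of_nonneg hP0.le hPn.le) hG0

end Torus

end Literature.Analysis.FunctionSpaces

namespace Literature.Analysis.FluidPDE

namespace BDSV

open FunctionSpaces FunctionSpaces.Torus

/-- A smooth function on the torus is `Cⁿ` for every natural `n`. [folklore] -/
private theorem isContDiff_natCast_of_isSmooth {F : Type*} [NormedAddCommGroup F]
    [NormedSpace ℝ F] {d : Type*} [Fintype d] {g : UnitAddTorus d → F} (hg : IsSmooth g) (n : ℕ) :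
    IsContDiff (n : WithTop ℕ∞) g :=
  hg.isContDiff (by exact_mod_cast le_top)

/-! ## The commutator: smoothness and the Leibniz rule

The commutator `[∂ᵢ∂ⱼΔ⁻¹, b·∇] f` is written throughout as the lambda
`fun x => rieszHessian i j (Torus.convect b f) x - Torus.convect b (rieszHessian i j f) x`,
literally as in the named fact `BDSV.commutatorCZBound`. -/

section Commutator

variable {b : UnitAddTorus (Fin 3) → EuclideanSpace ℝ (Fin 3)} {f : UnitAddTorus (Fin 3) → ℝ}

/-- The commutator `[∂ᵢ∂ⱼΔ⁻¹, b·∇] f` of smooth `b`, `f` is smooth. [folklore] -/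
theorem isSmooth_czCommutator (hb : IsSmooth b) (hf : IsSmooth f) (i j : Fin 3) :
    IsSmooth (fun x => rieszHessian i j (Torus.convect b f) x - Torus.convect b (rieszHessian i j f) x) :=
  (isSmooth_rieszHessian (hb.convect hf) i j).sub (hb.convect (isSmooth_rieszHessian hf i j))

/-- **Leibniz rule for the commutator** (BDSV App. D, proof of Prop. D.1:
"`∂^θ[T_K, b·∇]f = ∑_{θ'} (θ choose θ') [T_K, ∂^{θ'}b·∇] ∂^{θ-θ'}f`", the case `|θ| = 1`):
`∂ₖ [∂ᵢ∂ⱼΔ⁻¹, b·∇] f = [∂ᵢ∂ⱼΔ⁻¹, ∂ₖb·∇] f + [∂ᵢ∂ⱼΔ⁻¹, b·∇] ∂ₖf` for smooth `b`, `f`, since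
`∂ᵢ∂ⱼΔ⁻¹` commutes with `∂ₖ`. [cite: BuckmasterEtAl2018, App. D (proof of Prop. D.1)] -/
theorem partialDeriv_czCommutator (hb : IsSmooth b) (hf : IsSmooth f) (i j k : Fin 3) :
    partialDeriv k
        (fun x => rieszHessian i j (Torus.convect b f) x - Torus.convect b (rieszHessian i j f) x) =
      (fun x => rieszHessian i j (Torus.convect (partialDeriv k b) f) x -
          Torus.convect (partialDeriv k b) (rieszHessian i j f) x) +
        fun x => rieszHessian i j (Torus.convect b (partialDeriv k f)) x -
          Torus.convect b (rieszHessian i j (partialDeriv k f)) x := by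
  have hbf : IsSmooth (Torus.convect b f) := hb.convect hf
  have hRf : IsSmooth (rieszHessian i j f) := isSmooth_rieszHessian hf i j
  have hR : IsSmooth (rieszHessian i j (Torus.convect b f)) := isSmooth_rieszHessian hbf i j
  have hS : IsSmooth (Torus.convect b (rieszHessian i j f)) := hb.convect hRf
  have h1 : IsSmooth (Torus.convect (partialDeriv k b) f) := (hb.partialDeriv k).convect hf
  have h2 : IsSmooth (Torus.convect b (partialDeriv k f)) := hb.convect (hf.partialDeriv k)
  have hsub : (fun x => rieszHessian i j (Torus.convect b f) x - Torus.convect b (rieszHessian i j f) x) =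
      rieszHessian i j (Torus.convect b f) + -Torus.convect b (rieszHessian i j f) := by
    funext x
    exact sub_eq_add_neg _ _
  have hneg : ∀ x, partialDeriv k (-Torus.convect b (rieszHessian i j f)) x =
      -partialDeriv k (Torus.convect b (rieszHessian i j f)) x :=
    fun x => partialDeriv_neg k _ x
  rw [hsub, partialDeriv_add (hR.isContDiff (by simp)) (hS.neg.isContDiff (by simp)) k]
  funext x
  rw [Pi.add_apply, Pi.add_apply, hneg x, partialDeriv_rieszHessian hbf i j k,
    show partialDeriv k (Torus.convect b f) =
      Torus.convect (partialDeriv k b) f + Torus.convect b (partialDeriv k f) from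
        funext (partialDeriv_convect hb hf k),
    rieszHessian_add h1 h2, Pi.add_apply, partialDeriv_convect hb hRf k x]
  simp only [partialDeriv_rieszHessian hf i j k]
  ring

end Commutator

/-! ## Prop. D.1: all orders from order zero -/

section Orders

variable {α : ℝ≥0}

/-- **The induction step of BDSV's proof of Prop. D.1** (App. D: "Let us now consider the case
`N ≥ 1` … by the Leibniz rule … we obtain from the case `N = 0`:
`‖∂^θ[T_K, b·∇]f‖_α ≲ ∑_{j=0}^N ‖b‖_{j+1+α}‖f‖_{N-j+α}` … by interpolation …
`‖b‖_{j+1+α}‖f‖_{N-j+α} ≲ ‖b‖_{1+α}‖f‖_{N+α} + ‖b‖_{N+1+α}‖f‖_α`"), one derivative at a time: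
if the tame bound holds at order `N` with constant `C`, and `K` is an interpolation constant for
the two off-diagonal products `‖b‖_{2,α}‖f‖_{N,α}`, `‖b‖_{N+1,α}‖f‖_{1,α}`, then the tame bound
holds at order `N + 1` with constant `C (6K + 9)` (`‖g‖_{N+1,α} ≤ ‖g‖_∞ + ∑ₖ‖∂ₖg‖_{N,α}` and
`∂ₖ[T, b·∇]f = [T, ∂ₖb·∇]f + [T, b·∇]∂ₖf`). [cite: BuckmasterEtAl2018, App. D (proof of Prop. D.1)] -/
theorem czCommutator_bound_succ (hα1 : α ≤ 1) (N : ℕ) {C K : ℝ≥0}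
    (hK : ∀ (b : UnitAddTorus (Fin 3) → EuclideanSpace ℝ (Fin 3)) (f : UnitAddTorus (Fin 3) → ℝ), IsSmooth b → IsSmooth f →
      Torus.eContDiffHolderNorm 2 α b * Torus.eContDiffHolderNorm N α f ≤
          (K : ℝ≥0∞) * (Torus.eContDiffHolderNorm 1 α b * Torus.eContDiffHolderNorm (N + 1) α f +
            Torus.eContDiffHolderNorm (N + 1 + 1) α b * Torus.eContDiffHolderNorm 0 α f) ∧
        Torus.eContDiffHolderNorm (N + 1) α b * Torus.eContDiffHolderNorm 1 α f ≤
          (K : ℝ≥0∞) * (Torus.eContDiffHolderNorm 1 α b * Torus.eContDiffHolderNorm (N + 1) α f +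
            Torus.eContDiffHolderNorm (N + 1 + 1) α b * Torus.eContDiffHolderNorm 0 α f))
    (hC : ∀ (i j : Fin 3) (b : UnitAddTorus (Fin 3) → EuclideanSpace ℝ (Fin 3)) (f : UnitAddTorus (Fin 3) → ℝ), IsSmooth b → IsSmooth f →
      Torus.eContDiffHolderNorm N α
          (fun x => rieszHessian i j (Torus.convect b f) x - Torus.convect b (rieszHessian i j f) x) ≤
        (C : ℝ≥0∞) * (Torus.eContDiffHolderNorm 1 α b * Torus.eContDiffHolderNorm N α f +
          Torus.eContDiffHolderNorm (N + 1) α b * Torus.eContDiffHolderNorm 0 α f))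
    (i j : Fin 3) (b : UnitAddTorus (Fin 3) → EuclideanSpace ℝ (Fin 3)) (f : UnitAddTorus (Fin 3) → ℝ) (hb : IsSmooth b) (hf : IsSmooth f) :
    Torus.eContDiffHolderNorm (N + 1) α
        (fun x => rieszHessian i j (Torus.convect b f) x - Torus.convect b (rieszHessian i j f) x) ≤
      ((C * (6 * K + 9) : ℝ≥0) : ℝ≥0∞) *
        (Torus.eContDiffHolderNorm 1 α b * Torus.eContDiffHolderNorm (N + 1) α f +
          Torus.eContDiffHolderNorm (N + 1 + 1) α b * Torus.eContDiffHolderNorm 0 α f) := by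
  -- abbreviations: the right-hand side `S` and the three commutators
  set S : ℝ≥0∞ := Torus.eContDiffHolderNorm 1 α b * Torus.eContDiffHolderNorm (N + 1) α f +
    Torus.eContDiffHolderNorm (N + 1 + 1) α b * Torus.eContDiffHolderNorm 0 α f with hS
  set g : UnitAddTorus (Fin 3) → ℝ := fun x => rieszHessian i j (Torus.convect b f) x -
    Torus.convect b (rieszHessian i j f) x with hg
  have hsm : IsSmooth g := isSmooth_czCommutator hb hf i j
  -- the sup part
  have hsup : eSupNorm g ≤ 3 * (C : ℝ≥0∞) * S := by
    refine (Torus.eSupNorm_le_eContDiffHolderNorm N α _).trans ((hC i j b f hb hf).trans ?_)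
    have h1 : Torus.eContDiffHolderNorm N α f ≤ 3 * Torus.eContDiffHolderNorm (N + 1) α f :=
      Torus.eContDiffHolderNorm_le_three_mul_succ (isContDiff_natCast_of_isSmooth hf (N + 1)) hα1 α
    have h2 : Torus.eContDiffHolderNorm (N + 1) α b ≤
        3 * Torus.eContDiffHolderNorm (N + 1 + 1) α b :=
      Torus.eContDiffHolderNorm_le_three_mul_succ (isContDiff_natCast_of_isSmooth hb (N + 1 + 1))
        hα1 α
    calc (C : ℝ≥0∞) * (Torus.eContDiffHolderNorm 1 α b * Torus.eContDiffHolderNorm N α f +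
          Torus.eContDiffHolderNorm (N + 1) α b * Torus.eContDiffHolderNorm 0 α f)
        ≤ (C : ℝ≥0∞) * (Torus.eContDiffHolderNorm 1 α b * (3 * Torus.eContDiffHolderNorm (N + 1) α f) +
          (3 * Torus.eContDiffHolderNorm (N + 1 + 1) α b) * Torus.eContDiffHolderNorm 0 α f) := by
          gcongr
      _ = 3 * (C : ℝ≥0∞) * S := by rw [hS]; ring
  -- the derivative part, for each `k`
  have hder : ∀ k : Fin 3,
      Torus.eContDiffHolderNorm N α (partialDeriv k g) ≤ (C : ℝ≥0∞) * (2 * K + 2) * S := by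
    intro k
    have hkb : IsSmooth (partialDeriv k b) := hb.partialDeriv k
    have hkf : IsSmooth (partialDeriv k f) := hf.partialDeriv k
    set gA : UnitAddTorus (Fin 3) → ℝ := fun x => rieszHessian i j (Torus.convect (partialDeriv k b) f) x -
      Torus.convect (partialDeriv k b) (rieszHessian i j f) x with hgA
    set gB : UnitAddTorus (Fin 3) → ℝ := fun x => rieszHessian i j (Torus.convect b (partialDeriv k f)) x -
      Torus.convect b (rieszHessian i j (partialDeriv k f)) x with hgB
    have hsmA : IsSmooth gA := isSmooth_czCommutator hkb hf i j
    have hsmB : IsSmooth gB := isSmooth_czCommutator hb hkf i j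
    have hA' : Torus.eContDiffHolderNorm N α gA ≤ (C : ℝ≥0∞) * (K * S + S) := by
      refine (hC i j (partialDeriv k b) f hkb hf).trans ?_
      have e1 : Torus.eContDiffHolderNorm 1 α (partialDeriv k b) ≤ Torus.eContDiffHolderNorm 2 α b :=
        Torus.eContDiffHolderNorm_partialDeriv_le (isContDiff_natCast_of_isSmooth hb 2) k α
      have e2 : Torus.eContDiffHolderNorm (N + 1) α (partialDeriv k b) ≤
          Torus.eContDiffHolderNorm (N + 1 + 1) α b :=
        Torus.eContDiffHolderNorm_partialDeriv_le (isContDiff_natCast_of_isSmooth hb (N + 1 + 1)) k α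
      calc (C : ℝ≥0∞) * (Torus.eContDiffHolderNorm 1 α (partialDeriv k b) *
              Torus.eContDiffHolderNorm N α f +
            Torus.eContDiffHolderNorm (N + 1) α (partialDeriv k b) * Torus.eContDiffHolderNorm 0 α f)
          ≤ (C : ℝ≥0∞) * (Torus.eContDiffHolderNorm 2 α b * Torus.eContDiffHolderNorm N α f +
            Torus.eContDiffHolderNorm (N + 1 + 1) α b * Torus.eContDiffHolderNorm 0 α f) := by
            gcongr
        _ ≤ (C : ℝ≥0∞) * (K * S + S) :=
            mul_le_mul' le_rfl (add_le_add (hK b f hb hf).1 (by rw [hS]; exact le_add_self))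
    have hB' : Torus.eContDiffHolderNorm N α gB ≤ (C : ℝ≥0∞) * (S + K * S) := by
      refine (hC i j b (partialDeriv k f) hb hkf).trans ?_
      have e1 : Torus.eContDiffHolderNorm N α (partialDeriv k f) ≤
          Torus.eContDiffHolderNorm (N + 1) α f :=
        Torus.eContDiffHolderNorm_partialDeriv_le (isContDiff_natCast_of_isSmooth hf (N + 1)) k α
      have e2 : Torus.eContDiffHolderNorm 0 α (partialDeriv k f) ≤ Torus.eContDiffHolderNorm 1 α f :=
        Torus.eContDiffHolderNorm_partialDeriv_le (isContDiff_natCast_of_isSmooth hf 1) k α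
      calc (C : ℝ≥0∞) * (Torus.eContDiffHolderNorm 1 α b *
              Torus.eContDiffHolderNorm N α (partialDeriv k f) +
            Torus.eContDiffHolderNorm (N + 1) α b * Torus.eContDiffHolderNorm 0 α (partialDeriv k f))
          ≤ (C : ℝ≥0∞) * (Torus.eContDiffHolderNorm 1 α b * Torus.eContDiffHolderNorm (N + 1) α f +
            Torus.eContDiffHolderNorm (N + 1) α b * Torus.eContDiffHolderNorm 1 α f) := by
            gcongr
        _ ≤ (C : ℝ≥0∞) * (S + K * S) :=
            mul_le_mul' le_rfl (add_le_add (by rw [hS]; exact le_self_add) (hK b f hb hf).2)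
    have hsplit : partialDeriv k g = gA + gB := partialDeriv_czCommutator hb hf i j k
    rw [hsplit]
    calc Torus.eContDiffHolderNorm N α (gA + gB)
        ≤ Torus.eContDiffHolderNorm N α gA + Torus.eContDiffHolderNorm N α gB :=
          Torus.eContDiffHolderNorm_add_le (isContDiff_natCast_of_isSmooth hsmA N)
            (isContDiff_natCast_of_isSmooth hsmB N)
      _ ≤ (C : ℝ≥0∞) * (K * S + S) + (C : ℝ≥0∞) * (S + K * S) := add_le_add hA' hB'
      _ = (C : ℝ≥0∞) * (2 * K + 2) * S := by ring
  -- assemble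
  have hsum : ∑ k : Fin 3, Torus.eContDiffHolderNorm N α (partialDeriv k g) ≤
      3 * ((C : ℝ≥0∞) * (2 * K + 2) * S) := by
    calc ∑ k : Fin 3, Torus.eContDiffHolderNorm N α (partialDeriv k g)
        ≤ ∑ _k : Fin 3, (C : ℝ≥0∞) * (2 * K + 2) * S := Finset.sum_le_sum fun k _ => hder k
      _ = 3 * ((C : ℝ≥0∞) * (2 * K + 2) * S) := by
          rw [Finset.sum_const, Finset.card_univ, Fintype.card_fin, nsmul_eq_mul, Nat.cast_ofNat]
  calc Torus.eContDiffHolderNorm (N + 1) α g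
      ≤ eSupNorm g + ∑ k : Fin 3, Torus.eContDiffHolderNorm N α (partialDeriv k g) :=
        eContDiffHolderNorm_succ_le_sum hsm N α
    _ ≤ 3 * (C : ℝ≥0∞) * S + 3 * ((C : ℝ≥0∞) * (2 * K + 2) * S) := add_le_add hsup hsum
    _ = ((C * (6 * K + 9) : ℝ≥0) : ℝ≥0∞) * S := by
        push_cast
        ring

/-- **All orders from order zero** (BDSV App. D, proof of Prop. D.1: the case `N ≥ 1` follows
from the case `N = 0` by the Leibniz rule and interpolation). If for some `α ≤ 1` the
order-zero commutator estimate `‖[∂ᵢ∂ⱼΔ⁻¹, b·∇]f‖_{0,α} ≤ C₀ ‖b‖_{1,α}‖f‖_{0,α}` holds for all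
smooth `b`, `f`, then for every `N` there is `C = C(α, N)` with the tame estimate
`‖[∂ᵢ∂ⱼΔ⁻¹, b·∇]f‖_{N,α} ≤ C (‖b‖_{1,α}‖f‖_{N,α} + ‖b‖_{N+1,α}‖f‖_{0,α})`.
[cite: BuckmasterEtAl2018, App. D (proof of Prop. D.1)] -/
theorem czCommutator_bound_of_order_zero (hα1 : α ≤ 1) {C₀ : ℝ≥0}
    (h0 : ∀ (i j : Fin 3) (b : UnitAddTorus (Fin 3) → EuclideanSpace ℝ (Fin 3)) (f : UnitAddTorus (Fin 3) → ℝ), IsSmooth b → IsSmooth f →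
      Torus.eContDiffHolderNorm 0 α
          (fun x => rieszHessian i j (Torus.convect b f) x - Torus.convect b (rieszHessian i j f) x) ≤
        (C₀ : ℝ≥0∞) * (Torus.eContDiffHolderNorm 1 α b * Torus.eContDiffHolderNorm 0 α f))
    (N : ℕ) :
    ∃ C : ℝ≥0, ∀ (i j : Fin 3) (b : UnitAddTorus (Fin 3) → EuclideanSpace ℝ (Fin 3)) (f : UnitAddTorus (Fin 3) → ℝ), IsSmooth b → IsSmooth f →
      Torus.eContDiffHolderNorm N α
          (fun x => rieszHessian i j (Torus.convect b f) x - Torus.convect b (rieszHessian i j f) x) ≤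
        (C : ℝ≥0∞) * (Torus.eContDiffHolderNorm 1 α b * Torus.eContDiffHolderNorm N α f +
          Torus.eContDiffHolderNorm (N + 1) α b * Torus.eContDiffHolderNorm 0 α f) := by
  induction N with
  | zero =>
    refine ⟨C₀, fun i j b f hb hf => (h0 i j b f hb hf).trans ?_⟩
    gcongr
    exact le_self_add
  | succ N IH =>
    obtain ⟨C, hC⟩ := IH
    -- the interpolation constant for the span `N + 1` (orders `1 … N+2` of `b`, `0 … N+1` of `f`)
    obtain ⟨K, hK⟩ := Torus.exists_eContDiffHolderNorm_mul_le_ends (d := Fin 3) (Y := EuclideanSpace ℝ (Fin 3)) (Y' := ℝ)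
      1 0 (N + 1) hα1
    refine ⟨C * (6 * K + 9), fun i j b f hb hf => czCommutator_bound_succ hα1 N (C := C) (K := K)
      (fun b' f' hb' hf' => ⟨?_, ?_⟩) hC i j b f hb hf⟩
    · have h := hK b' f' hb' hf' 1 (by omega)
      rw [show 0 + (N + 1 - 1) = N from by omega, show 0 + (N + 1) = N + 1 from by omega,
        show 1 + (N + 1) = N + 1 + 1 from by omega] at h
      exact h
    · have h := hK b' f' hb' hf' N (by omega)
      rw [show 0 + (N + 1 - N) = 1 from by omega, show 0 + (N + 1) = N + 1 from by omega,
        show 1 + (N + 1) = N + 1 + 1 from by omega, show 1 + N = N + 1 from by omega] at h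
      exact h

/-- **BDSV App. D, Prop. D.1 from its order-zero case.** The named fact `BDSV.commutatorCZBound`
(the tame commutator estimate `‖[∂ᵢ∂ⱼΔ⁻¹, b·∇]f‖_{N+α} ≲ ‖b‖_{1+α}‖f‖_{N+α} + ‖b‖_{N+1+α}‖f‖_α`
for all `N`) follows from its case `N = 0`, `‖[∂ᵢ∂ⱼΔ⁻¹, b·∇]f‖_α ≲ ‖b‖_{1+α}‖f‖_α` (Constantin
2015, Lemma 1), exactly as printed: "Let us now consider the case `N ≥ 1` … Leibniz rule …
Therefore we obtain from the case `N = 0` … Furthermore, by interpolation … This concludes the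
proof." [cite: BuckmasterEtAl2018, App. D Prop. D.1 (proof, case N ≥ 1)] -/
theorem commutatorCZBound_of_order_zero
    (h0 : ∀ α : ℝ≥0, 0 < α → α < 1 → ∃ C₀ : ℝ≥0, ∀ (i j : Fin 3) (b : UnitAddTorus (Fin 3) → EuclideanSpace ℝ (Fin 3)) (f : UnitAddTorus (Fin 3) → ℝ),
      IsSmooth b → IsSmooth f →
        Torus.eContDiffHolderNorm 0 α
            (fun x => rieszHessian i j (Torus.convect b f) x - Torus.convect b (rieszHessian i j f) x) ≤
          C₀ * (Torus.eContDiffHolderNorm 1 α b * Torus.eContDiffHolderNorm 0 α f)) :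
    commutatorCZBound := by
  intro α hα0 hα1 N
  obtain ⟨C₀, hC₀⟩ := h0 α hα0 hα1
  exact czCommutator_bound_of_order_zero hα1.le hC₀ N

end Orders

end BDSV

end Literature.Analysis.FluidPDE
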